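import Mathlib.Topology.Algebra.Module.FiniteDimension
import Literature.NumberTheory.EllipticCurves.NewformGaloisRepModLAssembly
import Literature.NumberTheory.EllipticCurves.NewformGaloisRepModLOfPadicAlgClProofs
import Literature.NumberTheory.EllipticCurves.NewformGaloisRepDeligneOfThm61Proofs
import Literature.NumberTheory.EllipticCurves.NewformGaloisRepOfRegularAlgebraicProofs
import Literature.NumberTheory.Automorphic.ChebotarevArtinRepHolds
import Literature.RepresentationTheory.Semisimple.OddDescentFinTwo
import HarnessLib

/-!
# Deligne–Serre 1974, Thm. 6.1 (the named fact `thm61_exists_adicGaloisRep`) from Deligne's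
# theorem in `ℚ̄_ℓ`-form

A *proofs* file (theorems only: no definition, no named fact; D-0026) for the named fact
`Literature.NumberTheory.EllipticCurves.ModularForms.DeligneSerre1974.thm61_exists_adicGaloisRep`
(`NewformGaloisRepModLAssembly`; Deligne–Serre, *Formes modulaires de poids 1*, Ann. Sci. ÉNS (4)
7 (1974), Thm. 6.1, p. 520, crediting Deligne [4] = Sém. Bourbaki 355): for a cuspidal
`T_p`-eigenform `g ∈ S_k(Γ₁(M), χ)` (`p ∤ M`), `k ≥ 2`, a number field `K` (`e : K → ℂ`)
containing the eigenvalues `a_p` and the `χ(d)`, and EVERY finite place `v` of `K`, a continuous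
semisimple `ρ : Gal(ℚ̄/ℚ) → GL₂(K_v)` unramified at `p ∤ M`, `p ∉ v`, with
`det(X - ρ(F_p)) = X² - a_p X + χ(p) p^{k-1}` there.  That fact is the apex of the tree's Deligne
debt (SIZE XL: Deligne's construction — parabolic `ℓ`-adic cohomology of modular curves, the
Eichler–Shimura congruence relation — is in neither Mathlib nor `Literature/`).  The tree's
Langlands cone states Deligne's theorem in another language — over `ℚ̄_ℓ`, indexed by
`ι : ℚ̄_ℓ ≃ ℂ` (`NewformGaloisRepModLOfPadicAlgClProofs.thm67_weightOne_of_deligne_padicAlgCl'`,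
hypothesis `hD`; obtained from lang.S27 = Harris–Lan–Taylor–Thorne Thm. A and the adelic
dictionary in `NewformGaloisRepOfRegularAlgebraicProofs.deligne_padicAlgCl_of_langS27_of_dictionary`).
This file proves **Thm. 6.1 at every finite place from that `ℚ̄_ℓ`-form**:

* `thm61_exists_adicGaloisRep_of_deligne_padicAlgCl : hD → thm61_exists_adicGaloisRep`;
* `thm61_exists_adicGaloisRep_of_langS27_of_dictionary`,
  `thm61_exists_adicGaloisRep_of_theoremA_of_dictionary` — hence Thm. 6.1 from lang.S27
  (`exists_galoisRep_of_regularAlgebraic`), resp. from the existence half of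
  Harris–Lan–Taylor–Thorne's Thm. A (`HarrisLanTaylorThorne2016.theoremA_existence`), the
  compactness fact of the `GL₂/ℚ` automorphy datum and the adelic dictionary `hdict` for
  holomorphic eigenforms of weight `≥ 2` (all as in `NewformGaloisRepOfRegularAlgebraicProofs`).

So the named fact — and with it everything funnelled through it (`Ribet1977.thm21_exists_galoisRep`
by `NewformGaloisRepDeligneOfThm61Proofs`, Thm. 6.7 / Thm. 4.1 in weight one by
`NewformGaloisRepModLAssembly.thm67_weightOne_holds_of`) — follows from Deligne's theorem in the
`ℚ̄_ℓ`-form of the Langlands cone.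

## Proof (Deligne–Serre 1974, footnote (2) p. 521: realisability over `K_λ` via the complex
## conjugation)

Given `(g, χ, K, e, a, c, v)` as in Thm. 6.1, let `ℓ` be the residue characteristic of `v`.
1. `K_v` is a finite extension of `ℚ_ℓ` (`finiteDimensional_padic_adicCompletion`), so there is a
   `ℚ_ℓ`-embedding `ĵ : K_v → ℚ̄_ℓ`, automatically a closed topological embedding
   (`exists_isInducing_ringHom_adicCompletion_padicAlgCl`); by Steinitz
   (`exists_ringEquiv_padicAlgCl_complex_extends`) there is `ι : ℚ̄_ℓ ≃ ℂ` with
   `ι ∘ ĵ ∘ (K → K_v) = e`.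
2. `hD` at `(g, χ, e ∘ a, ℓ, ι)` gives `r : Gal(ℚ̄/ℚ) → GL₂(ℚ̄_ℓ)`, unramified at `p ∤ M ℓ` with
   `det(X - r(F_p)) = ĵ(X² - a_p X + c(p) p^{k-1})`.
3. `r` is **odd**: `det r` and `(ĵ ∘ c ∘ χ_M) · χ_ℓ^{k-1}` agree on these Frobenii, which are dense
   (Chebotarev, `absoluteGaloisGroup.frobenius_dense` with `chebotarev_artinRep_holds`), hence
   everywhere; at a complex conjugation `c₀` the right side is `χ(-1) (-1)^{k-1} = -1`, as
   `χ(-1) = (-1)^k` (`⟨-1⟩ = (-1)^k` on `S_k(Γ₁(M))`, `diamondOp_neg_one_apply`). Likewise the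
   traces of `r` lie in the closed subfield `ĵ(K_v)`, being `ĵ(a_p)` on a dense set.
4. **Descent** (`Literature.RepresentationTheory.Semisimple.exists_continuous_descent_fin_two_of_det_eq_neg_one`,
   op. cit. footnote (2)): a continuous `2`-dimensional representation with traces in `ĵ(K_v)`
   whose image contains an odd involution comes — with the same characteristic polynomials and
   kernel containment — from a continuous **semisimple** `ρ : Gal(ℚ̄/ℚ) → GL₂(K_v)`; unramifiedness
   and (6.1.1) transfer along the injection `ĵ`.

## References

* P. Deligne, J.-P. Serre, *Formes modulaires de poids 1*, Ann. Sci. ÉNS (4) 7 (1974), 507–530: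
  Thm. 6.1 (p. 520), footnote (2) (p. 521), Rem. 4.5. doi:10.24033/asens.1277
  [DeligneSerreASENS1974]
* P. Deligne, *Formes modulaires et représentations `ℓ`-adiques*, Sém. Bourbaki 355, LNM 179
  (1971), 139–172 (op. cit. [4]). [Deligne1971Bourbaki355]
* K. A. Ribet, *Galois representations attached to eigenforms with Nebentypus*, LNM 601 (1977),
  §2, Prop. (2.2) (`det ρ_ℓ = ε χ_ℓ^{k-1}`). [Ribet1977Nebentypus]
* M. Harris, K.-W. Lan, R. Taylor, J. Thorne, Res. Math. Sci. 3 (2016), Thm. A (the `ℚ̄_ℓ`/`ι`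
  normalisation). [HarrisLanTaylorThorneRMS2016]
-/

noncomputable section

open scoped MatrixGroups ModularForm NumberField Polynomial Topology

open CongruenceSubgroup IsDedekindDomain Polynomial Rat.HeightOneSpectrum Field Topology
  Literature.NumberTheory.GaloisRepresentations Literature.NumberTheory.Automorphic

namespace Literature.NumberTheory.EllipticCurves.ModularForms.DeligneSerre1974

/-! ### The residue characteristic of a finite place -/

/-- Every finite place `v` of a number field lies over a rational prime `ℓ` (the characteristic
of the finite field `𝓞 K / v`). [folklore] -/
theorem exists_prime_natCast_mem_heightOneSpectrum {K : Type*} [Field K] [NumberField K]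
    (v : HeightOneSpectrum (𝓞 K)) : ∃ ℓ : ℕ, ℓ.Prime ∧ ((ℓ : ℕ) : 𝓞 K) ∈ v.asIdeal := by
  haveI : v.asIdeal.IsPrime := v.isPrime
  haveI : Finite (𝓞 K ⧸ v.asIdeal) := Ideal.finiteQuotientOfFreeOfNeBot v.asIdeal v.ne_bot
  obtain ⟨q, hq⟩ := CharP.exists (𝓞 K ⧸ v.asIdeal)
  have hqprime : q.Prime := (CharP.char_is_prime_or_zero (𝓞 K ⧸ v.asIdeal) q).resolve_right
    (CharP.char_ne_zero_of_finite (𝓞 K ⧸ v.asIdeal) q)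
  refine ⟨q, hqprime, ?_⟩
  rw [← Ideal.Quotient.eq_zero_iff_mem, map_natCast]
  exact CharP.cast_eq_zero _ q

/-! ### `K_v ↪ ℚ̄_ℓ` as a closed topological embedding -/

section Embedding

variable {K : Type} [Field K] [NumberField K] (v : HeightOneSpectrum (𝓞 K)) (ℓ : ℕ) [Fact ℓ.Prime]

/-- **`K_v` embeds into `ℚ̄_ℓ` as a closed subfield, homeomorphically onto its image** (`v ∣ ℓ`).
`K_v` is a finite extension of `ℚ_ℓ` (`finiteDimensional_padic_adicCompletion`), so it admits a
`ℚ_ℓ`-embedding into the algebraic closure `ℚ̄_ℓ` (Mathlib `IsAlgClosed.lift`); a `ℚ_ℓ`-linear map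
out of a finite-dimensional Hausdorff space is continuous, its finite-dimensional image is closed,
and the corestriction is a homeomorphism (Mathlib `LinearEquiv.toContinuousLinearEquiv`), so the
embedding is inducing. (Serre, *Local Fields*, Ch. II §5; Neukirch, ANT Ch. II (8.2).) [folklore] -/
theorem exists_isInducing_ringHom_adicCompletion_padicAlgCl (hv : ((ℓ : ℕ) : 𝓞 K) ∈ v.asIdeal) :
    ∃ ĵ : v.adicCompletion K →+* PadicAlgCl ℓ, IsInducing ĵ ∧ IsClosed (Set.range ĵ) := by
  letI := LocalField.adicCompletionPadicAlgebra v ℓ hv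
  haveI := finiteDimensional_padic_adicCompletion v ℓ hv
  haveI : ContinuousSMul ℚ_[ℓ] (v.adicCompletion K) := continuousSMul_padic_adicCompletion v ℓ hv
  haveI : Algebra.IsAlgebraic ℚ_[ℓ] (v.adicCompletion K) := Algebra.IsAlgebraic.of_finite ℚ_[ℓ] _
  let ĵ : v.adicCompletion K →ₐ[ℚ_[ℓ]] PadicAlgCl ℓ := IsAlgClosed.lift
  -- the corestriction onto the (finite-dimensional, closed) image is a homeomorphism
  let W : Submodule ℚ_[ℓ] (PadicAlgCl ℓ) := LinearMap.range ĵ.toLinearMap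
  have hWclosed : IsClosed (W : Set (PadicAlgCl ℓ)) := W.closed_of_finiteDimensional
  let eW : v.adicCompletion K ≃ₗ[ℚ_[ℓ]] W :=
    LinearEquiv.ofInjective ĵ.toLinearMap ĵ.toRingHom.injective
  let eW' : v.adicCompletion K ≃L[ℚ_[ℓ]] W := eW.toContinuousLinearEquiv
  have hfac : (ĵ : v.adicCompletion K → PadicAlgCl ℓ) = Subtype.val ∘ eW' := by
    funext x
    rfl
  have hrange : Set.range (ĵ : v.adicCompletion K → PadicAlgCl ℓ) = W := by
    ext y
    simp [W, LinearMap.mem_range]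
  refine ⟨ĵ.toRingHom, ?_, ?_⟩
  · change IsInducing (ĵ : v.adicCompletion K → PadicAlgCl ℓ)
    rw [hfac]
    exact IsInducing.subtypeVal.comp eW'.toHomeomorph.isInducing
  · change IsClosed (Set.range (ĵ : v.adicCompletion K → PadicAlgCl ℓ))
    rw [hrange]
    exact hWclosed

end Embedding

/-! ### Parity of the nebentypus: `χ(-1) = (-1)^k` on a non-zero form of type `(k, χ)` -/

/-- For a non-zero cusp form `g ∈ S_k(Γ₁(M))` of nebentypus `χ`, `χ(-1) = (-1)^k`: the diamond
operator `⟨-1⟩` acts by `χ(-1)` on the `χ`-subspace and by `(-1)^k` on all of `S_k(Γ₁(M))`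
(`diamondOp_neg_one_apply`; Diamond–Shurman §4.3, p. 119; Deligne–Serre 1974, Rem. 4.5).
[cite: DiamondShurman2005, §4.3 p. 119] -/
theorem nebentypusSubspace_neg_one {M : ℕ} [NeZero M] {k : ℤ} {g : CuspForm (Gamma1 M) k}
    {χ : DirichletCharacter ℂ M} (hgχ : g ∈ nebentypusSubspace M k χ) (hg0 : g ≠ 0) :
    χ (-1) = (-1) ^ k := by
  have h := (mem_nebentypusSubspace_iff_diamondOp.mp hgχ) (-1)
  rw [Units.val_neg, Units.val_one, diamondOp_neg_one_apply] at h
  by_contra hne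
  have h' : ((-1 : ℂ) ^ k - χ (-1)) • g = 0 := by rw [sub_smul, h, sub_self]
  exact hg0 ((smul_eq_zero.mp h').resolve_left (sub_ne_zero.mpr (Ne.symm hne)))

/-! ### The `ℚ̄_ℓ`-representations of Deligne's theorem are odd -/

section Odd

variable {M : ℕ} [NeZero M] {k : ℤ}

set_option maxHeartbeats 800000 in
/-- **Deligne's `ℚ̄_ℓ`-representations are odd** (Ribet 1977, Prop. (2.2): `det ρ_ℓ = ε χ_ℓ^{k-1}`,
"by the Čebotarev density theorem"; Deligne–Serre 1974, Rem. 4.5; Diamond–Shurman, sequel to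
Thm. 9.6.5: `det ρ(conj) = -1`).  Let `g ∈ S_k(Γ₁(M), χ)`, `g ≠ 0`, `k ≥ 1`, `ι : ℚ̄_ℓ ≃ ℂ`, and
`r : Gal(ℚ̄/ℚ) → GL₂(ℚ̄_ℓ)` continuous with `det(X - r(F_p)) = X² - ι⁻¹(a_p) X + ι⁻¹(χ(p) p^{k-1})`
at the primes `p ∤ M`, `p ≠ ℓ`.  Then `det r(c) = -1` for every complex conjugation `c`: the
continuous functions `det ∘ r` and `σ ↦ ι⁻¹(χ(χ_M σ)) χ_ℓ(σ)^{k-1}` agree on those Frobenii (both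
are `ι⁻¹(χ(p)) p^{k-1}`), a dense set (`absoluteGaloisGroup.frobenius_dense`, Chebotarev
`chebotarev_artinRep_holds`), hence at `c`, where the latter is `χ(-1) (-1)^{k-1} = -1`
(`nebentypusSubspace_neg_one`). [cite: Ribet1977Nebentypus, Prop. (2.2)] -/
theorem isOdd_of_deligne_padicAlgCl (hk : 1 ≤ k) {g : CuspForm (Gamma1 M) k}
    {χ : DirichletCharacter ℂ M} (hgχ : g ∈ nebentypusSubspace M k χ) (hg0 : g ≠ 0)
    {ℓ : ℕ} [Fact ℓ.Prime] (ι : PadicAlgCl ℓ ≃+* ℂ) (a : ℕ → ℂ)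
    (r : FramedGaloisRep ℚ (PadicAlgCl ℓ) 2)
    (hr : ∀ w : HeightOneSpectrum (𝓞 ℚ), ¬ ((primesEquiv w : Nat.Primes) : ℕ) ∣ M →
      ((primesEquiv w : Nat.Primes) : ℕ) ≠ ℓ →
      r.IsUnramifiedAt w ∧
      r.HasFrobCharpolyAt w
        (X ^ 2 - C (ι.symm (a ((primesEquiv w : Nat.Primes) : ℕ))) * X +
          C (ι.symm (χ ((primesEquiv w : Nat.Primes) : ℕ) *
            (((primesEquiv w : Nat.Primes) : ℕ) : ℂ) ^ (k - 1))))) :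
    r.IsOdd := by
  classical
  intro φ c hc
  have hℓ : (ℓ : ℕ).Prime := Fact.out
  haveI : NeZero (M : ℚ) := NeZero.charZero
  -- the weight as a natural number exponent
  obtain ⟨m, hm⟩ : ∃ m : ℕ, ((m : ℕ) : ℤ) = k - 1 := ⟨(k - 1).toNat, Int.toNat_of_nonneg (by omega)⟩
  -- the finite exceptional set of places and the dense set of good Frobenii
  set S : Set (HeightOneSpectrum (𝓞 ℚ)) := {v | ((primesEquiv v : Nat.Primes) : ℕ) ∣ M * ℓ}
    with hSdef
  have hS : S.Finite := by
    have hfin : {n : ℕ | n ∣ M * ℓ}.Finite :=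
      (M * ℓ).divisors.finite_toSet.subset fun n hn ↦
        Nat.mem_divisors.mpr ⟨hn, mul_ne_zero (NeZero.ne M) hℓ.ne_zero⟩
    exact (hfin.preimage (f := fun v : HeightOneSpectrum (𝓞 ℚ) ↦ ((primesEquiv v : Nat.Primes) : ℕ))
      fun v _ w _ h ↦ primesEquiv.injective (Subtype.ext h)).subset fun v hv ↦ hv
  set D : Set (absoluteGaloisGroup ℚ) :=
    {σ | ∃ v ∉ S, ∃ 𝔓 ∈ v.primesAbove, IsArithFrobAt (𝓞 ℚ) σ 𝔓} with hDdef
  have hD : Dense D := absoluteGaloisGroup.frobenius_dense Automorphic.chebotarev_artinRep_holds ℚ S hS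
  -- the two continuous functions `det r` and `ι⁻¹(χ(χ_M)) · χ_ℓ^m`
  let aℓ : ℤ_[ℓ]ˣ → PadicAlgCl ℓ := fun u ↦ algebraMap ℚ_[ℓ] (PadicAlgCl ℓ) ((u : ℤ_[ℓ]) : ℚ_[ℓ])
  have hcoe : Continuous (fun x : ℤ_[ℓ] ↦ (x : ℚ_[ℓ])) := continuous_subtype_val
  have haℓ : Continuous aℓ :=
    (continuous_algebraMap ℚ_[ℓ] (PadicAlgCl ℓ)).comp (hcoe.comp Units.continuous_val)
  let F₁ : absoluteGaloisGroup ℚ → PadicAlgCl ℓ := fun σ ↦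
    ((r σ : GL (Fin 2) (PadicAlgCl ℓ)) : Matrix (Fin 2) (Fin 2) (PadicAlgCl ℓ)).det
  let F₂ : absoluteGaloisGroup ℚ → PadicAlgCl ℓ := fun σ ↦
    ι.symm (χ (modNCyclotomicCharacter ℚ M σ : ZMod M)) *
      aℓ (GaloisRep.cyclotomicCharacter ℚ ℓ σ) ^ m
  have hF₁ : Continuous F₁ := (Units.continuous_val.comp (map_continuous r)).matrix_det
  have hF₂ : Continuous F₂ :=
    (continuous_comp_modNCyclotomicCharacter ℚ M fun u ↦ ι.symm (χ (u : ZMod M))).mul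
      ((haℓ.comp (map_continuous _)).pow m)
  -- they agree on the good Frobenii
  have hagree : Set.EqOn F₁ F₂ D := by
    rintro σ ⟨v, hvS, 𝔓, h𝔓, hσ⟩
    haveI : 𝔓.IsPrime := h𝔓.1
    set p : ℕ := ((primesEquiv v : Nat.Primes) : ℕ) with hpdef
    have hp : p.Prime := (primesEquiv v).2
    have hpv : p = natGenerator v := rfl
    have hpMℓ : ¬ p ∣ M * ℓ := hvS
    have hpM : ¬ p ∣ M := fun h ↦ hpMℓ (h.mul_right ℓ)
    have hpℓ : ¬ p ∣ ℓ := fun h ↦ hpMℓ (h.mul_left M)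
    have hpℓ' : p ≠ ℓ := fun h ↦ hpℓ (h ▸ dvd_rfl)
    have hℓv : (ℓ : 𝓞 ℚ) ∉ v.asIdeal := by
      rw [Rat.natCast_mem_asIdeal_iff, ← hpv]
      exact hpℓ
    have hNP : (M : absIntegers (𝓞 ℚ) ℚ) ∉ 𝔓 := Rat.natCast_not_mem_of_mem_primesAbove_of_not_dvd h𝔓 hpM
    -- `det r(σ)` from the Frobenius polynomial
    obtain ⟨-, hchar⟩ := hr v hpM hpℓ'
    have h1 : F₁ σ = ι.symm (χ p) * (p : PadicAlgCl ℓ) ^ m := by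
      have hc' := hchar 𝔓 h𝔓 σ hσ
      rw [← hpdef] at hc'
      have hd := Matrix.det_eq_of_charpoly_eq hc'
      change F₁ σ = _ at hd
      rw [hd, map_mul, map_zpow₀, map_natCast ι.symm p, ← hm, zpow_natCast]
    -- `χ_M(σ) = p` and `χ_ℓ(σ) = p`
    have h2 : (modNCyclotomicCharacter ℚ M σ : ZMod M) = (p : ZMod M) := by
      rw [modNCyclotomicCharacter_eq_residueCard_of_isArithFrobAt h𝔓 hNP hσ,
        Rat.residueCard_eq_natGenerator, ← hpv]
    have h3 : aℓ (GaloisRep.cyclotomicCharacter ℚ ℓ σ) = (p : PadicAlgCl ℓ) := by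
      change algebraMap ℚ_[ℓ] (PadicAlgCl ℓ)
        ((GaloisRep.cyclotomicCharacter ℚ ℓ σ : ℤ_[ℓ]ˣ) : ℤ_[ℓ]) = _
      rw [GaloisRep.cyclotomicCharacter_apply_of_isArithFrobAt hℓv h𝔓 hσ,
        Rat.residueCard_eq_natGenerator, ← hpv]
      simp
    change F₁ σ = ι.symm (χ (modNCyclotomicCharacter ℚ M σ : ZMod M)) *
      aℓ (GaloisRep.cyclotomicCharacter ℚ ℓ σ) ^ m
    rw [h1, h2, h3]
  -- hence everywhere, in particular at the complex conjugation `c`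
  have hall : F₁ = F₂ := Continuous.ext_on hD hF₁ hF₂ hagree
  have hχN : (modNCyclotomicCharacter ℚ M c : ZMod M) = -1 :=
    modNCyclotomicCharacter_of_isComplexConjugation hc
  have hχℓ : aℓ (GaloisRep.cyclotomicCharacter ℚ ℓ c) = -1 := by
    change algebraMap ℚ_[ℓ] (PadicAlgCl ℓ) ((GaloisRep.cyclotomicCharacter ℚ ℓ c : ℤ_[ℓ]ˣ) : ℤ_[ℓ]) = _
    rw [GaloisRep.cyclotomicCharacter_of_isComplexConjugation ℓ hc]
    simp
  have hεc : ι.symm (χ (-1)) = (-1 : PadicAlgCl ℓ) ^ k := by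
    rw [nebentypusSubspace_neg_one hgχ hg0, map_zpow₀, map_neg, map_one]
  have hc2 : F₂ c = -1 := by
    change ι.symm (χ (modNCyclotomicCharacter ℚ M c : ZMod M)) *
      aℓ (GaloisRep.cyclotomicCharacter ℚ ℓ c) ^ m = -1
    rw [hχN, hεc, hχℓ, ← zpow_natCast, hm]
    rw [← zpow_add₀ (by norm_num : (-1 : PadicAlgCl ℓ) ≠ 0), show k + (k - 1) = 2 * k - 1 by ring,
      zpow_sub₀ (by norm_num : (-1 : PadicAlgCl ℓ) ≠ 0), _root_.zpow_mul]
    norm_num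
  apply Units.ext
  rw [Matrix.GeneralLinearGroup.val_det_apply, Units.val_neg, Units.val_one]
  change F₁ c = -1
  rw [hall, hc2]

end Odd

/-! ### Thm. 6.1 at every finite place from Deligne's theorem in `ℚ̄_ℓ`-form -/

section Main

set_option maxHeartbeats 800000 in
/-- **Deligne–Serre 1974, Thm. 6.1 at every finite place (the named fact
`thm61_exists_adicGaloisRep`) from Deligne's theorem in `ℚ̄_ℓ`-form.**  Hypothesis `hD`, verbatim
the hypothesis of `thm67_weightOne_of_deligne_padicAlgCl'` (the shape in which the tree's
Langlands cone delivers Deligne's theorem, `deligne_padicAlgCl_of_langS27_of_dictionary`): for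
every cuspidal eigenform `g ∈ S_k(Γ₁(M), χ)`, `k ≥ 2`, of the `T_p` (`p ∤ M`, eigenvalues
`a_p ∈ ℂ`), every prime `ℓ` and every `ι : ℚ̄_ℓ ≃+* ℂ`, a continuous semisimple
`r : Gal(ℚ̄/ℚ) → GL₂(ℚ̄_ℓ)` unramified at `p ∤ M`, `p ≠ ℓ`, with
`det(X - r(F_p)) = X² - ι⁻¹(a_p) X + ι⁻¹(χ(p) p^{k-1})`.  Conclusion: Thm. 6.1 as printed
(p. 520) — over `K_v` for every number field `K ∋ a_p, χ(d)` and **every** finite place `v`.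
Proof: `ℓ :=` the residue characteristic of `v`; a closed topological embedding
`ĵ : K_v → ℚ̄_ℓ` (`exists_isInducing_ringHom_adicCompletion_padicAlgCl`) and `ι : ℚ̄_ℓ ≃ ℂ`
with `ι ∘ ĵ|_K = e` (Steinitz, `exists_ringEquiv_padicAlgCl_complex_extends`); `hD` at
`(g, χ, e ∘ a, ℓ, ι)`; the resulting `r` is odd (`isOdd_of_deligne_padicAlgCl`) with traces in the
closed subfield `ĵ(K_v)` (true on the dense set of good Frobenii, Chebotarev); descend along `ĵ`
by the complex conjugation (`exists_continuous_descent_fin_two_of_det_eq_neg_one`, op. cit.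
footnote (2) p. 521), keeping characteristic polynomials (6.1.1) and unramifiedness.
[cite: DeligneSerreASENS1974, Thm. 6.1 (p. 520) and footnote (2) (p. 521)] -/
theorem thm61_exists_adicGaloisRep_of_deligne_padicAlgCl
    (hD : ∀ (M : ℕ) [NeZero M] (k : ℤ), 2 ≤ k →
      ∀ (g : CuspForm (Gamma1 M) k) (χ : DirichletCharacter ℂ M),
        g ∈ nebentypusSubspace M k χ → g ≠ 0 →
      ∀ (a : ℕ → ℂ),
        (∀ (p : ℕ) (hp : p.Prime), ¬ p ∣ M →
          (haveI : NeZero p := ⟨hp.ne_zero⟩; heckeT (Gamma1 M) k p g) = a p • g) →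
      ∀ (ℓ : ℕ) [Fact ℓ.Prime] (ι : PadicAlgCl ℓ ≃+* ℂ),
        ∃ r : GaloisRepresentations.FramedGaloisRep ℚ (PadicAlgCl ℓ) 2,
          r.toGaloisRep.IsSemisimple ∧
          ∀ w : HeightOneSpectrum (𝓞 ℚ), ¬ ((primesEquiv w : Nat.Primes) : ℕ) ∣ M →
            ((primesEquiv w : Nat.Primes) : ℕ) ≠ ℓ →
            r.IsUnramifiedAt w ∧
            r.HasFrobCharpolyAt w
              (X ^ 2 - C (ι.symm (a ((primesEquiv w : Nat.Primes) : ℕ))) * X +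
                C (ι.symm (χ ((primesEquiv w : Nat.Primes) : ℕ) *
                  (((primesEquiv w : Nat.Primes) : ℕ) : ℂ) ^ (k - 1))))) :
    thm61_exists_adicGaloisRep := by
  intro M _ k hk g χ hgχ hg0 K _ _ e a c hc hT v
  classical
  -- ### the residue characteristic `ℓ` of `v`
  obtain ⟨ℓ, hℓ, hℓv⟩ := exists_prime_natCast_mem_heightOneSpectrum v
  haveI : Fact ℓ.Prime := ⟨hℓ⟩
  -- ### `ĵ : K_v → ℚ̄_ℓ` and `ι : ℚ̄_ℓ ≃ ℂ` with `ι ∘ ĵ ∘ (K → K_v) = e`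
  obtain ⟨ĵ, hĵ, hĵclosed⟩ := exists_isInducing_ringHom_adicCompletion_padicAlgCl v ℓ hℓv
  set jK : K →+* PadicAlgCl ℓ := ĵ.comp (algebraMap K (v.adicCompletion K)) with hjKdef
  obtain ⟨ι, hι⟩ := exists_ringEquiv_padicAlgCl_complex_extends jK e
  have hιsymm : ∀ x : K, ι.symm (e x) = jK x := fun x ↦ by
    rw [← hι x, RingEquiv.symm_apply_apply]
  -- ### Deligne's theorem in `ℚ̄_ℓ`-form at `(g, χ, e ∘ a, ℓ, ι)`
  obtain ⟨r, -, hr⟩ := hD M k hk g χ hgχ hg0 (fun p ↦ e (a p)) hT ℓ ι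
  -- the Frobenius polynomials over `K`, and their images over `ℚ̄_ℓ`
  set P : HeightOneSpectrum (𝓞 ℚ) → K[X] := fun w ↦
    X ^ 2 - C (a ((primesEquiv w : Nat.Primes) : ℕ)) * X +
      C (c ((primesEquiv w : Nat.Primes) : ℕ) * (((primesEquiv w : Nat.Primes) : ℕ) : K) ^ (k - 1))
    with hPdef
  have hPmap : ∀ w : HeightOneSpectrum (𝓞 ℚ),
      (X ^ 2 - C (ι.symm (e (a ((primesEquiv w : Nat.Primes) : ℕ)))) * X +
        C (ι.symm (χ ((primesEquiv w : Nat.Primes) : ℕ) *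
          (((primesEquiv w : Nat.Primes) : ℕ) : ℂ) ^ (k - 1))) : (PadicAlgCl ℓ)[X]) =
        (P w).map jK := by
    intro w
    have h1 : χ (((primesEquiv w : Nat.Primes) : ℕ) : ZMod M) *
        (((primesEquiv w : Nat.Primes) : ℕ) : ℂ) ^ (k - 1) =
        e (c (((primesEquiv w : Nat.Primes) : ℕ) : ZMod M) *
          (((primesEquiv w : Nat.Primes) : ℕ) : K) ^ (k - 1)) := by
      rw [map_mul, map_zpow₀, hc, map_natCast e]
    rw [h1, hιsymm, hιsymm]
    simp only [hPdef, Polynomial.map_add, Polynomial.map_sub, Polynomial.map_mul,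
      Polynomial.map_pow, Polynomial.map_X, Polynomial.map_C]
  have hr' : ∀ w : HeightOneSpectrum (𝓞 ℚ), ¬ ((primesEquiv w : Nat.Primes) : ℕ) ∣ M →
      ((primesEquiv w : Nat.Primes) : ℕ) ≠ ℓ →
      r.IsUnramifiedAt w ∧ r.HasFrobCharpolyAt w ((P w).map jK) := by
    intro w hw hwℓ
    rw [← hPmap]
    exact hr w hw hwℓ
  -- ### `r` is odd: an odd involution `r(c₀)`, `c₀` a complex conjugation
  have hodd : r.IsOdd := isOdd_of_deligne_padicAlgCl (by omega) hgχ hg0 ι (fun p ↦ e (a p)) r hr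
  obtain ⟨c₀, hc₀⟩ := exists_isComplexConjugation (Rat.castHom ℝ)
  have hdetc : ((r c₀ : GL (Fin 2) (PadicAlgCl ℓ)) : Matrix (Fin 2) (Fin 2) (PadicAlgCl ℓ)).det = -1 := by
    have h := congrArg Units.val (hodd _ c₀ hc₀)
    rwa [Matrix.GeneralLinearGroup.val_det_apply, Units.val_neg, Units.val_one] at h
  have hcc : c₀ * c₀ = 1 := by
    have h := hc₀.sq_eq_one
    rwa [pow_two] at h
  -- ### the traces of `r` lie in the closed subfield `ĵ(K_v)`
  have htr : ∀ σ : absoluteGaloisGroup ℚ,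
      ((r σ : GL (Fin 2) (PadicAlgCl ℓ)) : Matrix (Fin 2) (Fin 2) (PadicAlgCl ℓ)).trace ∈
        Set.range ĵ := by
    set S : Set (HeightOneSpectrum (𝓞 ℚ)) := {v | ((primesEquiv v : Nat.Primes) : ℕ) ∣ M * ℓ}
      with hSdef
    have hS : S.Finite := by
      have hfin : {n : ℕ | n ∣ M * ℓ}.Finite :=
        (M * ℓ).divisors.finite_toSet.subset fun n hn ↦
          Nat.mem_divisors.mpr ⟨hn, mul_ne_zero (NeZero.ne M) hℓ.ne_zero⟩
      exact (hfin.preimage (f := fun v : HeightOneSpectrum (𝓞 ℚ) ↦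
        ((primesEquiv v : Nat.Primes) : ℕ)) fun v _ w _ h ↦
          primesEquiv.injective (Subtype.ext h)).subset fun v hv ↦ hv
    have hDense := absoluteGaloisGroup.frobenius_dense Automorphic.chebotarev_artinRep_holds ℚ S hS
    set T : Set (absoluteGaloisGroup ℚ) := {σ |
      ((r σ : GL (Fin 2) (PadicAlgCl ℓ)) : Matrix (Fin 2) (Fin 2) (PadicAlgCl ℓ)).trace ∈
        Set.range ĵ} with hTdef
    have hTclosed : IsClosed T := hĵclosed.preimage (FramedRep.continuous_trace r)
    have hsub : {σ : absoluteGaloisGroup ℚ |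
        ∃ v ∉ S, ∃ 𝔓 ∈ v.primesAbove, IsArithFrobAt (𝓞 ℚ) σ 𝔓} ⊆ T := by
      rintro σ ⟨w, hwS, 𝔓, h𝔓, hσ⟩
      set p : ℕ := ((primesEquiv w : Nat.Primes) : ℕ) with hpdef
      have hpMℓ : ¬ p ∣ M * ℓ := hwS
      have hpM : ¬ p ∣ M := fun h ↦ hpMℓ (h.mul_right ℓ)
      have hpℓ : p ≠ ℓ := fun h ↦ hpMℓ (h ▸ dvd_mul_left p M)
      obtain ⟨-, hchar⟩ := hr' w hpM hpℓ
      have hc' := hchar 𝔓 h𝔓 σ hσ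
      simp only [hPdef, Polynomial.map_add, Polynomial.map_sub, Polynomial.map_mul,
        Polynomial.map_pow, Polynomial.map_X, Polynomial.map_C] at hc'
      -- the trace is minus the coefficient of `X` in `det(X - r(σ))`
      have ht : ((r σ : GL (Fin 2) (PadicAlgCl ℓ)) : Matrix (Fin 2) (Fin 2) (PadicAlgCl ℓ)).trace =
          jK (a p) := by
        rw [Matrix.trace_eq_neg_charpoly_coeff]
        change -(FramedRep.charpoly r σ).coeff (Fintype.card (Fin 2) - 1) = _
        rw [hc']
        simp [hpdef]
      refine ⟨algebraMap K (v.adicCompletion K) (a p), ?_⟩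
      change _ = FramedRep.trace r σ
      rw [FramedRep.trace, ht, hjKdef, RingHom.comp_apply]
    have hTdense : Dense T := hDense.mono hsub
    intro σ
    have hσ : σ ∈ closure T := by
      rw [hTdense.closure_eq]
      exact Set.mem_univ σ
    rwa [hTclosed.closure_eq] at hσ
  -- ### descent along `ĵ` (Deligne–Serre, footnote (2) p. 521)
  obtain ⟨ρ, hρss, hρchar, hρker⟩ :=
    Literature.RepresentationTheory.Semisimple.exists_continuous_descent_fin_two_of_det_eq_neg_one
      ĵ hĵ r two_ne_zero htr hcc hdetc
  refine ⟨ρ, hρss, fun w hw hwv ↦ ?_⟩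
  set p : ℕ := ((primesEquiv w : Nat.Primes) : ℕ) with hpdef
  have hpℓ : p ≠ ℓ := by
    intro h
    apply hwv
    rw [h]
    exact hℓv
  obtain ⟨hunr, hchar⟩ := hr' w hw hpℓ
  refine ⟨fun 𝔓 h𝔓 σ hσ ↦ hρker σ (hunr 𝔓 h𝔓 σ hσ), fun 𝔓 h𝔓 σ hσ ↦ ?_⟩
  have h1 := hchar 𝔓 h𝔓 σ hσ
  have h2 := hρchar σ
  apply Polynomial.map_injective ĵ ĵ.injective
  change (((ρ σ : GL (Fin 2) (v.adicCompletion K)) :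
    Matrix (Fin 2) (Fin 2) (v.adicCompletion K)).charpoly).map ĵ = ((P w).map _).map ĵ
  rw [← Matrix.charpoly_map, h2, Polynomial.map_map]
  exact h1

end Main

/-! ### Thm. 6.1 modulo lang.S27 / Harris–Lan–Taylor–Thorne Thm. A and the adelic dictionary -/

section Langlands

/-- **Deligne–Serre 1974, Thm. 6.1 at every finite place modulo lang.S27 and the adelic
dictionary.** `thm61_exists_adicGaloisRep` follows from the tree's lang.S27
(`exists_galoisRep_of_regularAlgebraic`: Harris–Lan–Taylor–Thorne 2016, Thm. A with Varma), the
compactness fact `hcpt` of the `GL₂/ℚ` automorphy datum, and the dictionary `hdict` (eigenform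
`g ∈ S_k(Γ₁(M), χ)`, `k ≥ 2` ↦ regular algebraic cuspidal `π` on `GL₂(𝔸_ℚ)` with Satake
parameter `{(√p β₁)⁻¹, (√p β₂)⁻¹}` at `p ∤ M`, `β_j` the roots of `X² - a_p X + χ(p) p^{k-1}`;
Gelbart 1975, Prop. 3.1, Lemma 3.7; Clozel 1990, §3.5): `thm61_exists_adicGaloisRep_of_deligne_padicAlgCl`
after `deligne_padicAlgCl_of_langS27_of_dictionary`.
[cite: DeligneSerreASENS1974, Thm. 6.1 (p. 520)] [cite: HarrisLanTaylorThorneRMS2016, Thm. A (p. 3)] -/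
theorem thm61_exists_adicGaloisRep_of_langS27_of_dictionary
    (h27 : exists_galoisRep_of_regularAlgebraic)
    (hcpt : isCompact_glFiniteIntegralLevel 2 ℚ)
    (hdict : ∀ (M : ℕ) [NeZero M] (k : ℤ), 2 ≤ k →
      ∀ (g : CuspForm (Gamma1 M) k) (χ : DirichletCharacter ℂ M),
        g ∈ nebentypusSubspace M k χ → g ≠ 0 →
      ∀ (a : ℕ → ℂ),
        (∀ (p : ℕ) (hp : p.Prime), ¬ p ∣ M →
          (haveI : NeZero p := ⟨hp.ne_zero⟩; heckeT (Gamma1 M) k p g) = a p • g) →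
      ∃ π : CuspidalAutomorphicRepData 2 ℚ hcpt, π.1.IsRegularAlgebraic ∧
        ∀ w : HeightOneSpectrum (𝓞 ℚ), ¬ ((primesEquiv w : Nat.Primes) : ℕ) ∣ M →
          π.1.HasSatakeParamAt w
            ((X ^ 2 - C (a ((primesEquiv w : Nat.Primes) : ℕ)) * X +
                C (χ ((primesEquiv w : Nat.Primes) : ℕ) *
                  (((primesEquiv w : Nat.Primes) : ℕ) : ℂ) ^ (k - 1)) : ℂ[X]).roots.map
              fun β ↦ (((Real.sqrt ((primesEquiv w : Nat.Primes) : ℕ) : ℝ) : ℂ) * β)⁻¹)) :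
    thm61_exists_adicGaloisRep :=
  thm61_exists_adicGaloisRep_of_deligne_padicAlgCl
    (fun M _ k hk g χ hg hg0 a haT ℓ _ ι ↦
      deligne_padicAlgCl_of_langS27_of_dictionary h27 hcpt hdict M k hk g χ hg hg0 a haT ℓ ι)

/-- **Deligne–Serre 1974, Thm. 6.1 at every finite place modulo Harris–Lan–Taylor–Thorne's
Thm. A (existence) and the adelic dictionary**: as
`thm61_exists_adicGaloisRep_of_langS27_of_dictionary` with the named fact
`HarrisLanTaylorThorne2016.theoremA_existence` (over `ℚ`) in place of lang.S27.
[cite: DeligneSerreASENS1974, Thm. 6.1 (p. 520)] [cite: HarrisLanTaylorThorneRMS2016, Thm. A (p. 3)] -/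
theorem thm61_exists_adicGaloisRep_of_theoremA_of_dictionary
    (hA : HarrisLanTaylorThorne2016.theoremA_existence)
    (hcpt : isCompact_glFiniteIntegralLevel 2 ℚ)
    (hdict : ∀ (M : ℕ) [NeZero M] (k : ℤ), 2 ≤ k →
      ∀ (g : CuspForm (Gamma1 M) k) (χ : DirichletCharacter ℂ M),
        g ∈ nebentypusSubspace M k χ → g ≠ 0 →
      ∀ (a : ℕ → ℂ),
        (∀ (p : ℕ) (hp : p.Prime), ¬ p ∣ M →
          (haveI : NeZero p := ⟨hp.ne_zero⟩; heckeT (Gamma1 M) k p g) = a p • g) →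
      ∃ π : CuspidalAutomorphicRepData 2 ℚ hcpt, π.1.IsRegularAlgebraic ∧
        ∀ w : HeightOneSpectrum (𝓞 ℚ), ¬ ((primesEquiv w : Nat.Primes) : ℕ) ∣ M →
          π.1.HasSatakeParamAt w
            ((X ^ 2 - C (a ((primesEquiv w : Nat.Primes) : ℕ)) * X +
                C (χ ((primesEquiv w : Nat.Primes) : ℕ) *
                  (((primesEquiv w : Nat.Primes) : ℕ) : ℂ) ^ (k - 1)) : ℂ[X]).roots.map
              fun β ↦ (((Real.sqrt ((primesEquiv w : Nat.Primes) : ℕ) : ℝ) : ℂ) * β)⁻¹)) :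
    thm61_exists_adicGaloisRep :=
  thm61_exists_adicGaloisRep_of_deligne_padicAlgCl
    (fun M _ k hk g χ hg hg0 a haT ℓ _ ι ↦
      deligne_padicAlgCl_of_theoremA_of_dictionary hA hcpt hdict M k hk g χ hg hg0 a haT ℓ ι)

end Langlands

end Literature.NumberTheory.EllipticCurves.ModularForms.DeligneSerre1974

end
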